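/-
Copyright: cell pub-balaban-gaps, seat ne8 (estimate NE7c), gen 18. Project licence.
-/
import Literature.MathematicalPhysics.QuantumFieldTheory.Balaban1983to89.T4ShellMeasure

/-!
# The POINTWISE CASCADE of road (δ) for GENUINE THRESHOLD TESTS of an ADAPTIVE decision tree: at ONE configuration, over all `n` candidate
# factors and all `S` live stages, the booked tests whose REAL tested values lie in their two-sided shells number at most `2(∏_σ(ν_σ + 1) − 1)` —
# `T4ShellMeasure` §8's abstract count (flip indices as data) instantiated by the flip indices OF REAL THRESHOLD TESTS, the tree's `livePaths`
# identified with the paths of the OUTCOME VECTORS (row NE7c; junction J-26a; MODEL-level combinatorics, [folklore])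

Cell `pub-balaban-gaps` (G2), seat ne8, estimate **NE7c** (`T4IndicatorShell.ShellWeightBound`; two-run artefact, NOT PRINTED in [Bałaban 1983–89], NOT
PROVED).  Proof-only file under `Spine/NE7c/`: imports the tree's `Balaban1983to89.T4ShellMeasure` only (§8: `LiveStage`, `livePaths`, `LiveStage.hits` ∕
`hitsAbove`, `sum_hits₂_livePaths_le`, `exists_flipIndex_threshold`, `ownShell_subset_candShell`, `flipIndex_eq_of_mem_candShell`,
`flipIndex_eq_of_mem_aboveShell`, `flipIndex_eq_zero_of_le`, `twoSidedShell`).  NO definition (the path of an outcome vector is a bare `Nat.rec`), classical decidability for the real-valued filters; 0 `sorry`.  Companion of this seat's files 39 `LiveFactorCascadeSharp`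
(J-22: the count is ATTAINED) and 47 `LiveFactorJointLawModel` (J-25: a FIXED battery under any joint law, `V = S`); the measure-level lift of the present
count to ADAPTIVE trees under any joint law (cells indexed by the outcome vectors `ω : τ → Bool`, file 47's generic cell lemmas) is the successor file
`LiveFactorAdaptiveTreeModel` (J-26b).

THE QUESTION.  `T4ShellMeasure` §8 proves the cascade count `Σ_σ Σ_{i<n} (hits + hitsAbove) + 2 ≤ 2·∏_σ(ν_σ + 1)` for ABSTRACT stages `⟨tests, flip, next⟩`
whose flip indices are DATA (`LiveStage.flip : α → τ → ℕ`), along the tree's own `livePaths`.  Road (δ)'s reading (R) says: the flip index of a booked test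
IS the flip index of the real threshold test `u_t(x) < θ_t·(1 − ρ⋆)^i` of the configuration `x`, and a test contributes shell weight at candidate `i` only if
`u_t(x)` lies in its two-sided shell `twoSidedShell θ_t ρ⋆ ρ_t i`.  Is the count, SO INSTANTIATED, a bound on the number of booked tests found in their shells
along the ACTUAL adaptive path (the path driven by the outcomes of the real tests), summed over candidates and stages — with no hypothesis left on `flip`?

ANSWER ([folklore]):
* §1 the path determined by an OUTCOME VECTOR `ω : τ → Bool` — `Nat.rec a₀ (fun σ a => next σ a {t ∈ tests σ a | ω t}) σ` (stage `σ` at older value `a`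
  books `tests σ a` and moves by `next`); `path_succ` (computation rule); **`livePaths_eq_pathOf`**: for tested values `y : τ → ℝ`, thresholds `θ`, factor `c` and
  ANY flip indices `φ t` of the tests `y t < θ_t c^i` on `i ≤ n`, the tree's `livePaths ⟨tests σ, fun _ => φ, next σ⟩ a₀ σ i` IS the path of the outcome vector `t ↦ (y t < θ_t c^i)` through `σ` stages
  for every `σ` and `i ≤ n` (induction; `Finset.filter_congr`).
* §2 **`flipIndex_of_mem_twoSidedShell`**: `0 ≤ θ`, `0 ≤ ρ ≤ ρ⋆ ≤ 1`, `i < n`: `u ∈ twoSidedShell θ ρ⋆ ρ i ⇒ φ = i + 1 ∨ φ = i` (below the threshold: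
  `ownShell_subset_candShell` + `flipIndex_eq_of_mem_candShell`; at or above: `flipIndex_eq_of_mem_aboveShell` for `i ≥ 1`, `flipIndex_eq_zero_of_le` at
  `i = 0`); `card_filter_shell_le`: on any finite set of booked tests `#{shell} ≤ #{φ = i + 1} + #{φ = i}` (= the stage's `hits + hitsAbove`).
* §3 **`sum_card_shell_le_cascade`**: for ANY adaptive tree (`tests`, `next`, `a₀`) with `#tests σ a ≤ ν_σ`, ANY values `y`, thresholds `θ ≥ 0`, radii
  `0 ≤ ρ_t ≤ ρ⋆`, `0 ≤ ρ⋆ ≤ 1`, ANY `n`, `S`: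
  `Σ_{i<n} Σ_{σ<S} #{t ∈ tests σ (path(ω_i) σ) : y_t ∈ twoSidedShell θ_t ρ⋆ ρ_t i} + 2 ≤ 2·∏_{σ<S}(ν_σ + 1)`, `ω_i = (t ↦ y_t < θ_t(1 − ρ⋆)^i)` — the flip indices
  are CHOSEN (`choose` on `exists_flipIndex_threshold`), fed to `sum_hits₂_livePaths_le`, and eliminated by §1–§2: NO hypothesis on `flip` remains.

WHAT THIS SHOWS ∕ DOES NOT SHOW (honest).  SHOWS: the (R)+(W1) count of the (δ-1) member holds for genuine real threshold tests along the genuine adaptive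
path, pointwise in the configuration, with the tree's constant `V = 2(∏_σ(ν_σ+1) − 1)` and NOTHING assumed about the tests beyond `#tests ≤ ν_σ` per stage
and older value (in particular: arbitrary dependence of which tests are booked on the history; arbitrary real values).  DOES NOT SHOW: the measure-level
statement (integrating the count against a run's law and firing the constructor — successor file J-26b), anything about Bałaban's terms [B14] (2.18) (node O:
WHICH tree), (L1-step), two-run closeness.  BY-NAME EFFECT ON THE WALL: none (MODEL-level combinatorics).  VERDICT WORD UNCHANGED: WORK-bound behind node O;
INSTANCE 0∕1.  NE7c ∕ NE7b NOT PRINTED ∕ NOT PROVED; spine 0∕9; one finite T⁴ — NOT ℝ⁴, NOT infinite volume, NOT the mass gap, NOT Clay.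
HONEST DEPENDENCY (cell): continuum YM on T⁴ ⇐ BetaPertH ∧ nine spine estimates (0∕9 proved); BetaPertH ⇐ (D1) ∧ (D4) ∧ CAP+tail.
-/

set_option autoImplicit false

noncomputable section

open MeasureTheory Finset Set
open scoped Classical
open Literature.MathematicalPhysics.QuantumFieldTheory.Balaban1983to89
open Literature.MathematicalPhysics.QuantumFieldTheory.Balaban1983to89.T4ShellMeasure

namespace Summit.QuantumFields.BalabanUV.T4Continuum.Spine.NE7c.LiveFactorAdaptiveCascade

/-! ## §1 The path of an adaptive decision tree determined by an outcome vector -/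

section Path

variable {α τ : Type*}

/-- The PATH of the decision tree determined by an OUTCOME VECTOR `ω : τ → Bool` (which test labels read small) — written as a bare `Nat.rec` (no
definition is introduced): from the dead prefix `a₀`, stage `σ` books the tests `tests σ a` at the older value `a` and moves to `next σ a T`, `T` = the booked
tests reading small; this is its computation rule at a successor stage. [folklore] -/
theorem path_succ (tests : ℕ → α → Finset τ) (next : ℕ → α → Finset τ → α) (a₀ : α) (ω : τ → Bool) (σ : ℕ) :
    Nat.rec (motive := fun _ => α) a₀ (fun σ a => next σ a ((tests σ a).filter fun t => ω t = true)) (σ + 1) =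
      next σ (Nat.rec (motive := fun _ => α) a₀ (fun σ a => next σ a ((tests σ a).filter fun t => ω t = true)) σ)
        ((tests σ (Nat.rec (motive := fun _ => α) a₀ (fun σ a => next σ a ((tests σ a).filter fun t => ω t = true)) σ)).filter fun t => ω t = true) :=
  rfl

/-- **THE TREE's `livePaths` ARE THE PATHS OF THE OUTCOME VECTORS.**  Read at a configuration with tested VALUES `y : τ → ℝ`, thresholds `θ_t` and the common
factor `c`: if `φ t` is a flip index of the test `y t < θ_t·c^i` on `i ≤ n` (`exists_flipIndex_threshold`), then the tree's path through `σ` live stages at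
candidate `i ≤ n` (`T4ShellMeasure.livePaths` of the stages `⟨tests σ, fun _ => φ, next σ⟩`) is the path of the outcome vector `t ↦ (y t < θ_t·c^i)`. [folklore] -/
theorem livePaths_eq_pathOf (tests : ℕ → α → Finset τ) (next : ℕ → α → Finset τ → α) (a₀ : α) (y θ : τ → ℝ) (c : ℝ) {n : ℕ}
    (φ : τ → ℕ) (hφ : ∀ t, ∀ i ≤ n, (y t < θ t * c ^ i ↔ i < φ t)) :
    ∀ σ, ∀ i ≤ n, livePaths (fun σ => (⟨tests σ, fun _ => φ, next σ⟩ : LiveStage α τ)) a₀ σ i =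
      Nat.rec (motive := fun _ => α) a₀ (fun σ a => next σ a ((tests σ a).filter fun t => decide (y t < θ t * c ^ i) = true)) σ
  | 0, i, _ => rfl
  | σ + 1, i, hi => by
    have ih := livePaths_eq_pathOf tests next a₀ y θ c φ hφ σ i hi
    rw [path_succ tests next a₀ (fun t => decide (y t < θ t * c ^ i)) σ]
    simp only [livePaths, LiveStage.path]
    rw [ih]
    congr 1
    refine Finset.filter_congr fun t _ => ?_
    rw [← hφ t i hi, decide_eq_true_iff]

end Path

/-! ## §2 A tested value in its two-sided shell at candidate `i` is a HIT of the tree at `i` (flip index `i + 1`) or a HIT ABOVE (flip index `i`) -/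

section Hits

variable {τ : Type*}

/-- In the two-sided shell of candidate `i < n` ⇒ flip index `i + 1` (below the threshold) or `i` (at or above it); `0 ≤ θ`, `0 ≤ ρ ≤ ρ⋆ ≤ 1`. [folklore] -/
theorem flipIndex_of_mem_twoSidedShell {u θ ρ ρstar : ℝ} {n φ i : ℕ} (hθ : 0 ≤ θ) (h0 : 0 ≤ ρ) (hle : ρ ≤ ρstar) (h1 : ρstar ≤ 1)
    (hφ : ∀ j ≤ n, (u < θ * (1 - ρstar) ^ j ↔ j < φ)) (hi : i < n) (hu : u ∈ twoSidedShell θ ρstar ρ i) :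
    φ = i + 1 ∨ φ = i := by
  simp only [twoSidedShell, Set.mem_Ico] at hu
  by_cases hlt : u < θ * (1 - ρstar) ^ i
  · exact Or.inl (flipIndex_eq_of_mem_candShell hφ (by omega) (ownShell_subset_candShell hθ hle h1 i ⟨hu.1, hlt⟩))
  · right
    rw [not_lt] at hlt
    cases i with
    | zero =>
      rw [pow_zero, mul_one] at hlt
      exact flipIndex_eq_zero_of_le hφ hlt
    | succ i => exact flipIndex_eq_of_mem_aboveShell hθ h0 hle h1 hφ (by omega) ⟨hlt, hu.2⟩

/-- … hence, stage by stage, the booked tests whose values lie in their two-sided shells at candidate `i` are at most the HITS plus the HITS ABOVE of the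
stage at `i`. [folklore] -/
theorem card_filter_shell_le (B : Finset τ) (y θ ρ : τ → ℝ) {ρstar : ℝ} {n i : ℕ} (φ : τ → ℕ) (hθ : ∀ t, 0 ≤ θ t) (h0 : ∀ t, 0 ≤ ρ t)
    (hle : ∀ t, ρ t ≤ ρstar) (h1 : ρstar ≤ 1) (hφ : ∀ t, ∀ j ≤ n, (y t < θ t * (1 - ρstar) ^ j ↔ j < φ t)) (hi : i < n) :
    (B.filter fun t => y t ∈ twoSidedShell (θ t) ρstar (ρ t) i).card ≤
      (B.filter fun t => φ t = i + 1).card + (B.filter fun t => φ t = i).card := by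
  calc (B.filter fun t => y t ∈ twoSidedShell (θ t) ρstar (ρ t) i).card
      ≤ ((B.filter fun t => φ t = i + 1) ∪ (B.filter fun t => φ t = i)).card := by
        refine card_le_card fun t ht => ?_
        rw [Finset.mem_filter] at ht
        rw [Finset.mem_union, Finset.mem_filter, Finset.mem_filter]
        rcases flipIndex_of_mem_twoSidedShell (hθ t) (h0 t) (hle t) h1 (hφ t) hi ht.2 with h | h
        · exact Or.inl ⟨ht.1, h⟩
        · exact Or.inr ⟨ht.1, h⟩
    _ ≤ _ := card_union_le _ _

end Hits

/-! ## §3 THE POINTWISE CASCADE FOR REAL THRESHOLD TESTS: over all candidates and stages, the booked tests found in their two-sided shells number at most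
`2(∏_σ(ν_σ + 1) − 1)` -/

section Cascade

variable {α τ : Type*} [DecidableEq α]

/-- **THE POINTWISE CASCADE** (reading (R) + count (W1) at ONE configuration, for GENUINE threshold tests of real values): an adaptive tree with at most
`ν_σ` booked tests per stage and older value, tested values `y_t`, thresholds `θ_t ≥ 0`, radii `0 ≤ ρ_t ≤ ρ⋆ ≤ 1`, `n` candidate factors `(1 − ρ⋆)^i`:
`Σ_{i<n} Σ_{σ<S} #{t ∈ tests σ (path_i σ) : y_t ∈ twoSidedShell θ_t ρ⋆ ρ_t i} + 2 ≤ 2·∏_{σ<S}(ν_σ + 1)`, `path_i` = the path of the outcome vector at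
candidate `i`, a bare `Nat.rec` (`T4ShellMeasure.sum_hits₂_livePaths_le` + §1 + §2). [folklore] -/
theorem sum_card_shell_le_cascade (tests : ℕ → α → Finset τ) (next : ℕ → α → Finset τ → α) (a₀ : α) (ν : ℕ → ℕ)
    (hν : ∀ σ a, (tests σ a).card ≤ ν σ) (y θ ρ : τ → ℝ) {ρstar : ℝ} (hθ : ∀ t, 0 ≤ θ t) (h0 : ∀ t, 0 ≤ ρ t) (hle : ∀ t, ρ t ≤ ρstar)
    (hs0 : 0 ≤ ρstar) (h1 : ρstar ≤ 1) (n S : ℕ) :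
    (∑ i ∈ range n, ∑ σ ∈ range S,
        ((tests σ (Nat.rec (motive := fun _ => α) a₀ (fun σ a => next σ a ((tests σ a).filter fun t => decide (y t < θ t * (1 - ρstar) ^ i) = true)) σ)).filter
          fun t => y t ∈ twoSidedShell (θ t) ρstar (ρ t) i).card) + 2 ≤ 2 * ∏ σ ∈ range S, (ν σ + 1) := by
  choose φ _hφn hφ using fun t =>
    exists_flipIndex_threshold (u := y t) (θ := θ t) (c := 1 - ρstar) (hθ t) (by linarith) (by linarith) n
  have hcas := sum_hits₂_livePaths_le (fun σ => (⟨tests σ, fun _ => φ, next σ⟩ : LiveStage α τ)) a₀ n ν (fun σ a => hν σ a) S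
  have hle' : ∀ i ∈ range n, ∀ σ ∈ range S,
      ((tests σ (Nat.rec (motive := fun _ => α) a₀ (fun σ a => next σ a ((tests σ a).filter fun t => decide (y t < θ t * (1 - ρstar) ^ i) = true)) σ)).filter
          fun t => y t ∈ twoSidedShell (θ t) ρstar (ρ t) i).card ≤
        ((fun σ => (⟨tests σ, fun _ => φ, next σ⟩ : LiveStage α τ)) σ).hits
            (livePaths (fun σ => (⟨tests σ, fun _ => φ, next σ⟩ : LiveStage α τ)) a₀ σ) i +
          ((fun σ => (⟨tests σ, fun _ => φ, next σ⟩ : LiveStage α τ)) σ).hitsAbove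
            (livePaths (fun σ => (⟨tests σ, fun _ => φ, next σ⟩ : LiveStage α τ)) a₀ σ) i := by
    intro i hi σ _
    rw [Finset.mem_range] at hi
    have hp := livePaths_eq_pathOf tests next a₀ y θ (1 - ρstar) φ hφ σ i hi.le
    simp only [LiveStage.hits, LiveStage.hitsAbove]
    rw [hp]
    exact card_filter_shell_le _ y θ ρ φ hθ h0 hle h1 hφ hi
  calc (∑ i ∈ range n, ∑ σ ∈ range S,
          ((tests σ (Nat.rec (motive := fun _ => α) a₀ (fun σ a => next σ a ((tests σ a).filter fun t => decide (y t < θ t * (1 - ρstar) ^ i) = true)) σ)).filter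
            fun t => y t ∈ twoSidedShell (θ t) ρstar (ρ t) i).card) + 2
      ≤ (∑ i ∈ range n, ∑ σ ∈ range S,
          (((fun σ => (⟨tests σ, fun _ => φ, next σ⟩ : LiveStage α τ)) σ).hits
              (livePaths (fun σ => (⟨tests σ, fun _ => φ, next σ⟩ : LiveStage α τ)) a₀ σ) i +
            ((fun σ => (⟨tests σ, fun _ => φ, next σ⟩ : LiveStage α τ)) σ).hitsAbove
              (livePaths (fun σ => (⟨tests σ, fun _ => φ, next σ⟩ : LiveStage α τ)) a₀ σ) i)) + 2 := by
        gcongr with i hi σ hσ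
        exact hle' i hi σ hσ
    _ = (∑ σ ∈ range S, ∑ i ∈ range n,
          (((fun σ => (⟨tests σ, fun _ => φ, next σ⟩ : LiveStage α τ)) σ).hits
              (livePaths (fun σ => (⟨tests σ, fun _ => φ, next σ⟩ : LiveStage α τ)) a₀ σ) i +
            ((fun σ => (⟨tests σ, fun _ => φ, next σ⟩ : LiveStage α τ)) σ).hitsAbove
              (livePaths (fun σ => (⟨tests σ, fun _ => φ, next σ⟩ : LiveStage α τ)) a₀ σ) i)) + 2 := by
        rw [sum_comm]
    _ ≤ 2 * ∏ σ ∈ range S, (ν σ + 1) := hcas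

end Cascade

end Summit.QuantumFields.BalabanUV.T4Continuum.Spine.NE7c.LiveFactorAdaptiveCascade

end
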